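import Mathlib
import Summits.KontsevichZagierPeriods.KontsevichZagierPeriods.Theorems.SoloInformedLegendreRelation
import Summits.KontsevichZagierPeriods.KontsevichZagierPeriods.Theorems.SoloInformedLegendreLemniscatic
import Summits.KontsevichZagierPeriods.KontsevichZagierPeriods.Theorems.SoloInformedDecidedHulls
import HarnessLib
import HarnessLib.Audit

/-!
# SoloInformed — Legendre relation IX: the decided elliptic sector at `k² = ½` (THEOREM XVIII)

Solo-informed residency (s33), file IX of the Legendre chain: the first ELLIPTIC sector of the
formal period ring on which the Kontsevich–Zagier period conjecture is decided in the kernel.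

Let `K = K(1/√2)`, `E = E(1/√2)` be the complete elliptic integrals at the lemniscatic
(self-complementary) modulus, as one-dimensional representations on `(0,1)`.  Inputs:
* THEOREM XVII at `μ = ½` (`K' = K`, `E' = E`): `2·(2⟦E⟧⟦K⟧ − ⟦K⟧²) = ⟦π⟧` in `P`
  (`soloInformed_legendre_relation_half`) — Legendre's relation degenerates to
  `K(2E − K) = π/2`;
* file VIII: `⟦K⟧ = ⟦[pt,√2/4]⟧·⟦β(¼,½)⟧`, so `B(¼,½)² = 8K²`;
* Chudnovsky's theorem `π, Γ(¼)` algebraically independent, in the form `B(¼,½), π` independent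
  (s22 `SoloInformedLemniscateValues`).
Hence `K(1/√2), E(1/√2)` are algebraically independent over `ℚ`
(`soloInformed_algebraicIndependent_ellipticHalf`; classically: `ℚ̄(K,E) = ℚ̄(Γ(¼)², π)` up to a
finite extension), and by algebraic descent on `K`-hulls (s22 `SoloInformedAlgebraicHull`):

**THEOREM XVIII** (`soloInformed_kzp_on_hull_ellipticHalf`).  On the `K`-hull
`K[⟦K(1/√2)⟧, ⟦E(1/√2)⟧] ⊂ P` (all polynomials in the two classes with coefficients point classes
of algebraic numbers) the period conjecture holds: two representations of any dimensions whose
classes lie in the hull and whose values agree are equivalent under the Kontsevich–Zagier moves.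
The hull contains `⟦π⟧`, `⟦β(¼,½)⟧`, `⟦β(¼,¼)⟧` (`soloInformed_*_mem_hull_ellipticHalf`), so it
extends the decided hull `K[⟦β(¼,½)⟧,⟦π⟧]` of Theorem IX⁗ by the second-kind period `E(1/√2)`,
which is NOT in the old hull's value field (`E = K/2 + π/(4K)`).

Finally THEOREM XVII′-K (`soloInformed_kzp_on_hull_elliptic_of_algebraicIndependent`): for EVERY real
algebraic modulus, algebraic independence of `K, K', E, E'` (Grothendieck's period conjecture for
`H¹(E_μ)`, concrete form) implies the Kontsevich–Zagier conjecture on the sector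
`K[⟦K⟧,⟦K'⟧,⟦E⟧,⟦E'⟧] ∋ ⟦π⟧` — the transcendence input is the only input.

References: A. M. Legendre (1811/1825); Whittaker–Watson §§ 22.735–22.736, 22.8;
G. V. Chudnovsky, *Contributions to the theory of transcendental numbers* (1984), Ch. 7, Cor. 2.3;
Kontsevich–Zagier, *Periods* (2001) § 1.2; this work (solo-informed s22, s33).
-/

noncomputable section

open MeasureTheory Set Filter
open scoped Classical

open Literature.NumberTheory.Transcendental Literature.NumberTheory.Transcendental.KZ
open Literature.ModelTheory.ExponentialFields

namespace Summit.KontsevichZagierPeriods.KontsevichZagierPeriods.Theorems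

/-! ### Legendre's relation at the self-complementary modulus -/

/-- **Legendre at `k² = ½`**: `2·(⟦E⟧⟦K⟧ + ⟦E⟧⟦K⟧ − ⟦K⟧⟦K⟧) = ⟦π⟧` in the formal period ring
(THEOREM XVII with `K' = K`, `E' = E`). [this work] -/
theorem soloInformed_legendre_relation_half (K E : IntegralRep 1)
    (hKd : K.domain = {x : Fin 1 → ℝ | x 0 ∈ Ioo (0:ℝ) 1})
    (hKi : EqOn K.integrand
      (fun x => (√(1 - x 0 ^ 2))⁻¹ * (√(1 - (1 / 2 : ℝ) * x 0 ^ 2))⁻¹) K.domain)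
    (hEd : E.domain = {x : Fin 1 → ℝ | x 0 ∈ Ioo (0:ℝ) 1})
    (hEi : EqOn E.integrand (fun x => (1 - (1 / 2 : ℝ) * x 0 ^ 2) *
      ((√(1 - x 0 ^ 2))⁻¹ * (√(1 - (1 / 2 : ℝ) * x 0 ^ 2))⁻¹)) E.domain) :
    2 * (toFormalPeriod (of E) * toFormalPeriod (of K) + toFormalPeriod (of E) * toFormalPeriod (of K)
      - toFormalPeriod (of K) * toFormalPeriod (of K)) = toFormalPeriod (of KZ.piRep) := by
  have hhalf : (1 - (1 / 2 : ℝ)) = 1 / 2 := by norm_num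
  have hμ : (1 / 2 : ℝ) ∈ Ioo (0:ℝ) 1 := ⟨by norm_num, by norm_num⟩
  have hμa : IsAlgebraic ℚ (1 / 2 : ℝ) := by
    simpa using (isAlgebraic_nat (R := ℚ) (A := ℝ) 2).inv
  have hK'i : EqOn K.integrand
      (fun x => (√(1 - x 0 ^ 2))⁻¹ * (√(1 - (1 - (1 / 2 : ℝ)) * x 0 ^ 2))⁻¹) K.domain := by
    rw [hhalf]; exact hKi
  have hE'i : EqOn E.integrand (fun x => (1 - (1 - (1 / 2 : ℝ)) * x 0 ^ 2) *
      ((√(1 - x 0 ^ 2))⁻¹ * (√(1 - (1 - (1 / 2 : ℝ)) * x 0 ^ 2))⁻¹)) E.domain := by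
    rw [hhalf]; exact hEi
  exact soloInformed_legendre_relation (1 / 2) hμ hμa K K E E hKd hKi hKd hK'i hEd hEi hEd hE'i

/-- **Legendre at `k² = ½`, value form**: `2·(2·E·K − K²) = π`, i.e. `K(2E − K) = π/2`.
[Legendre 1811; this work] -/
theorem soloInformed_legendre_relation_half_value (K E : IntegralRep 1)
    (hKd : K.domain = {x : Fin 1 → ℝ | x 0 ∈ Ioo (0:ℝ) 1})
    (hKi : EqOn K.integrand
      (fun x => (√(1 - x 0 ^ 2))⁻¹ * (√(1 - (1 / 2 : ℝ) * x 0 ^ 2))⁻¹) K.domain)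
    (hEd : E.domain = {x : Fin 1 → ℝ | x 0 ∈ Ioo (0:ℝ) 1})
    (hEi : EqOn E.integrand (fun x => (1 - (1 / 2 : ℝ) * x 0 ^ 2) *
      ((√(1 - x 0 ^ 2))⁻¹ * (√(1 - (1 / 2 : ℝ) * x 0 ^ 2))⁻¹)) E.domain) :
    2 * (2 * E.value * K.value - K.value ^ 2) = Real.pi := by
  have h := congrArg evalP (soloInformed_legendre_relation_half K E hKd hKi hEd hEi)
  simp only [map_mul, map_add, map_sub, map_ofNat, evalP_toFormalPeriod_of, KZ.piRep_value] at h
  rw [← h]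
  ring

/-! ### Algebraic independence of `K(1/√2), E(1/√2)` -/

/-- **`K(1/√2)` and `E(1/√2)` are algebraically independent over `ℚ`**: `B(¼,½)² = 8K²` and
`π = 2(2EK − K²)` place `B(¼,½), π` algebraic over `ℚ(K,E)`, and `B(¼,½), π` are independent
(Chudnovsky). [Chudnovsky 1984, Ch. 7; this work] -/
theorem soloInformed_algebraicIndependent_ellipticHalf (K E : IntegralRep 1)
    (hKd : K.domain = {x : Fin 1 → ℝ | x 0 ∈ Ioo (0:ℝ) 1})
    (hKi : EqOn K.integrand
      (fun x => (√(1 - x 0 ^ 2))⁻¹ * (√(1 - (1 / 2 : ℝ) * x 0 ^ 2))⁻¹) K.domain)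
    (hEd : E.domain = {x : Fin 1 → ℝ | x 0 ∈ Ioo (0:ℝ) 1})
    (hEi : EqOn E.integrand (fun x => (1 - (1 / 2 : ℝ) * x 0 ^ 2) *
      ((√(1 - x 0 ^ 2))⁻¹ * (√(1 - (1 / 2 : ℝ) * x 0 ^ 2))⁻¹)) E.domain) :
    AlgebraicIndependent ℚ ![K.value, E.value] := by
  obtain ⟨B, hBd, hBi⟩ := exists_betaRep' (1 / 4) (1 / 2) (by norm_num) (by norm_num)
  have hBi' : EqOn B.integrand
      (fun t => (t 0) ^ (((1 / 4 : ℚ) : ℝ) - 1) * (1 - t 0) ^ (((1 / 2 : ℚ) : ℝ) - 1)) B.domain := by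
    rw [hBi]; exact fun _ _ => rfl
  set F : IntermediateField ℚ ℝ := IntermediateField.adjoin ℚ ({K.value, E.value} : Set ℝ)
    with hF
  have hKF : K.value ∈ F := IntermediateField.subset_adjoin ℚ _ (by simp)
  have hEF : E.value ∈ F := IntermediateField.subset_adjoin ℚ _ (by simp)
  refine soloInformed_algebraicIndependent_pair_transfer
    (soloInformed_algebraicIndependent_betaQuarterHalf_pi B hBd hBi') ⟨2, two_pos, ?_⟩
    ⟨1, one_pos, ?_⟩
  · rw [soloInformed_beta_sq_eq_eight_mul_ellipticK_half_sq K B hKd hKi hBd hBi']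
    exact mul_mem (by exact_mod_cast F.natCast_mem 8) (pow_mem hKF 2)
  · rw [pow_one, ← soloInformed_legendre_relation_half_value K E hKd hKi hEd hEi]
    exact mul_mem (by exact_mod_cast F.natCast_mem 2)
      (sub_mem (mul_mem (mul_mem (by exact_mod_cast F.natCast_mem 2) hEF) hKF) (pow_mem hKF 2))

/-- `E(1/√2)` is transcendental. [folklore; this work] -/
theorem soloInformed_transcendental_ellipticE_half (K E : IntegralRep 1)
    (hKd : K.domain = {x : Fin 1 → ℝ | x 0 ∈ Ioo (0:ℝ) 1})
    (hKi : EqOn K.integrand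
      (fun x => (√(1 - x 0 ^ 2))⁻¹ * (√(1 - (1 / 2 : ℝ) * x 0 ^ 2))⁻¹) K.domain)
    (hEd : E.domain = {x : Fin 1 → ℝ | x 0 ∈ Ioo (0:ℝ) 1})
    (hEi : EqOn E.integrand (fun x => (1 - (1 / 2 : ℝ) * x 0 ^ 2) *
      ((√(1 - x 0 ^ 2))⁻¹ * (√(1 - (1 / 2 : ℝ) * x 0 ^ 2))⁻¹)) E.domain) :
    Transcendental ℚ E.value := by
  have h := (soloInformed_algebraicIndependent_ellipticHalf K E hKd hKi hEd hEi).transcendental 1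
  simpa using h

/-! ### THEOREM XVIII: the `K`-hull of `⟦K(1/√2)⟧, ⟦E(1/√2)⟧` is decided -/

/-- **THEOREM XVIII (decided elliptic sector at the lemniscatic modulus).**  On the `K`-hull
`K[⟦K(1/√2)⟧, ⟦E(1/√2)⟧] ⊂ P` the Kontsevich–Zagier period conjecture holds: representations (any
dimensions) with classes in the hull and equal values are equivalent under the moves.  Inputs:
THEOREM XVII at `μ = ½` (a theorem of the calculus), the lemniscatic identity of file VIII, and
Chudnovsky's theorem on `π, Γ(¼)`. [this work] -/
theorem soloInformed_kzp_on_hull_ellipticHalf (K E : IntegralRep 1)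
    (hKd : K.domain = {x : Fin 1 → ℝ | x 0 ∈ Ioo (0:ℝ) 1})
    (hKi : EqOn K.integrand
      (fun x => (√(1 - x 0 ^ 2))⁻¹ * (√(1 - (1 / 2 : ℝ) * x 0 ^ 2))⁻¹) K.domain)
    (hEd : E.domain = {x : Fin 1 → ℝ | x 0 ∈ Ioo (0:ℝ) 1})
    (hEi : EqOn E.integrand (fun x => (1 - (1 / 2 : ℝ) * x 0 ^ 2) *
      ((√(1 - x 0 ^ 2))⁻¹ * (√(1 - (1 / 2 : ℝ) * x 0 ^ 2))⁻¹)) E.domain)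
    {n m : ℕ} (r : IntegralRep n) (r' : IntegralRep m)
    (hr : toFormalPeriod (of r) ∈
      soloInformedAlgHull ![toFormalPeriod (of K), toFormalPeriod (of E)])
    (hr' : toFormalPeriod (of r') ∈
      soloInformedAlgHull ![toFormalPeriod (of K), toFormalPeriod (of E)])
    (hv : r.value = r'.value) : Equivalent r r' := by
  refine soloInformed_kzp_on_algHull _ (soloInformed_algebraicIndependent_evalP_pair ?_)
    r r' hr hr' hv
  rw [evalP_toFormalPeriod_of, evalP_toFormalPeriod_of]
  exact soloInformed_algebraicIndependent_ellipticHalf K E hKd hKi hEd hEi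

/-- **Equality in `P` is decided by values on the hull**: two elements of
`K[⟦K(1/√2)⟧, ⟦E(1/√2)⟧]` with the same value are equal. [this work] -/
theorem soloInformed_eq_of_value_eq_on_hull_ellipticHalf (K E : IntegralRep 1)
    (hKd : K.domain = {x : Fin 1 → ℝ | x 0 ∈ Ioo (0:ℝ) 1})
    (hKi : EqOn K.integrand
      (fun x => (√(1 - x 0 ^ 2))⁻¹ * (√(1 - (1 / 2 : ℝ) * x 0 ^ 2))⁻¹) K.domain)
    (hEd : E.domain = {x : Fin 1 → ℝ | x 0 ∈ Ioo (0:ℝ) 1})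
    (hEi : EqOn E.integrand (fun x => (1 - (1 / 2 : ℝ) * x 0 ^ 2) *
      ((√(1 - x 0 ^ 2))⁻¹ * (√(1 - (1 / 2 : ℝ) * x 0 ^ 2))⁻¹)) E.domain)
    {x y : FormalPeriodRing}
    (hx : x ∈ soloInformedAlgHull ![toFormalPeriod (of K), toFormalPeriod (of E)])
    (hy : y ∈ soloInformedAlgHull ![toFormalPeriod (of K), toFormalPeriod (of E)])
    (h : evalP x = evalP y) : x = y := by
  refine soloInformed_eq_of_evalP_eq_of_mem_algHull _
    (soloInformed_algebraicIndependent_evalP_pair ?_) hx hy h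
  rw [evalP_toFormalPeriod_of, evalP_toFormalPeriod_of]
  exact soloInformed_algebraicIndependent_ellipticHalf K E hKd hKi hEd hEi

/-! ### What the hull contains: `⟦π⟧`, `⟦β(¼,½)⟧`, `⟦β(¼,¼)⟧` -/

/-- `⟦π⟧ ∈ K[⟦K(1/√2)⟧, ⟦E(1/√2)⟧]` — by Legendre's relation in `P`. [this work] -/
theorem soloInformed_piRep_mem_hull_ellipticHalf (K E : IntegralRep 1)
    (hKd : K.domain = {x : Fin 1 → ℝ | x 0 ∈ Ioo (0:ℝ) 1})
    (hKi : EqOn K.integrand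
      (fun x => (√(1 - x 0 ^ 2))⁻¹ * (√(1 - (1 / 2 : ℝ) * x 0 ^ 2))⁻¹) K.domain)
    (hEd : E.domain = {x : Fin 1 → ℝ | x 0 ∈ Ioo (0:ℝ) 1})
    (hEi : EqOn E.integrand (fun x => (1 - (1 / 2 : ℝ) * x 0 ^ 2) *
      ((√(1 - x 0 ^ 2))⁻¹ * (√(1 - (1 / 2 : ℝ) * x 0 ^ 2))⁻¹)) E.domain) :
    toFormalPeriod (of KZ.piRep) ∈
      soloInformedAlgHull ![toFormalPeriod (of K), toFormalPeriod (of E)] := by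
  rw [← soloInformed_legendre_relation_half K E hKd hKi hEd hEi]
  have hK := soloInformed_mem_algHull_self ![toFormalPeriod (of K), toFormalPeriod (of E)] 0
  have hE := soloInformed_mem_algHull_self ![toFormalPeriod (of K), toFormalPeriod (of E)] 1
  simp only [Matrix.cons_val_zero, Matrix.cons_val_one] at hK hE
  exact mul_mem (ofNat_mem _ 2)
    (sub_mem (add_mem (mul_mem hE hK) (mul_mem hE hK)) (mul_mem hK hK))

/-- `⟦β(¼,½)⟧ ∈ K[⟦K(1/√2)⟧, ⟦E(1/√2)⟧]` — by the lemniscatic identity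
`⟦K⟧ = ⟦[pt,√2/4]⟧·⟦β(¼,½)⟧` and the unit `⟦[pt, (√2/4)⁻¹]⟧`. [this work] -/
theorem soloInformed_betaQuarterHalf_mem_hull_ellipticHalf (K E B : IntegralRep 1)
    (hKd : K.domain = {x : Fin 1 → ℝ | x 0 ∈ Ioo (0:ℝ) 1})
    (hKi : EqOn K.integrand
      (fun x => (√(1 - x 0 ^ 2))⁻¹ * (√(1 - (1 / 2 : ℝ) * x 0 ^ 2))⁻¹) K.domain)
    (hBd : B.domain = {t | t 0 ∈ Ioo (0:ℝ) 1})
    (hBi : EqOn B.integrand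
      (fun t => (t 0) ^ (((1 / 4 : ℚ) : ℝ) - 1) * (1 - t 0) ^ (((1 / 2 : ℚ) : ℝ) - 1)) B.domain) :
    toFormalPeriod (of B) ∈ soloInformedAlgHull ![toFormalPeriod (of K), toFormalPeriod (of E)] := by
  have hc := soloInformed_isAlgebraic_sqrt_two_div_four
  have hc0 : (√2 / 4 : ℝ) ≠ 0 := by positivity
  have hci : IsAlgebraic ℚ (√2 / 4 : ℝ)⁻¹ := hc.inv
  have hK := soloInformed_mem_algHull_self ![toFormalPeriod (of K), toFormalPeriod (of E)] 0
  simp only [Matrix.cons_val_zero] at hK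
  have hB : toFormalPeriod (of B) =
      toFormalPeriod (of (IntegralRep.unit.constMul (√2 / 4 : ℝ)⁻¹ hci)) * toFormalPeriod (of K) := by
    rw [soloInformed_ellipticK_half_eq_beta K B hKd hKi hBd hBi hc, ← mul_assoc,
      soloInformed_pointRep_inv_mul _ hc hc0 hci, one_mul]
  rw [hB]
  exact mul_mem (soloInformed_pointRep_mem_algHull _ _ hci) hK

/-- `⟦β(¼,¼)⟧ ∈ K[⟦K(1/√2)⟧, ⟦E(1/√2)⟧]` — via `⟦β(¼,½)⟧` and the duplication chain of s22.
[this work] -/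
theorem soloInformed_betaQuarterQuarter_mem_hull_ellipticHalf (K E A B : IntegralRep 1)
    (hKd : K.domain = {x : Fin 1 → ℝ | x 0 ∈ Ioo (0:ℝ) 1})
    (hKi : EqOn K.integrand
      (fun x => (√(1 - x 0 ^ 2))⁻¹ * (√(1 - (1 / 2 : ℝ) * x 0 ^ 2))⁻¹) K.domain)
    (hAd : A.domain = {t | t 0 ∈ Ioo (0:ℝ) 1})
    (hAi : EqOn A.integrand
      (fun t => (t 0) ^ (((1 / 4 : ℚ) : ℝ) - 1) * (1 - t 0) ^ (((1 / 4 : ℚ) : ℝ) - 1)) A.domain)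
    (hBd : B.domain = {t | t 0 ∈ Ioo (0:ℝ) 1})
    (hBi : EqOn B.integrand
      (fun t => (t 0) ^ (((1 / 4 : ℚ) : ℝ) - 1) * (1 - t 0) ^ (((1 / 2 : ℚ) : ℝ) - 1)) B.domain) :
    toFormalPeriod (of A) ∈ soloInformedAlgHull ![toFormalPeriod (of K), toFormalPeriod (of E)] :=
  soloInformed_betaSymm_mem_algHull (1 / 4) A B hAd hAi hBd hBi _
    (soloInformed_betaQuarterHalf_mem_hull_ellipticHalf K E B hKd hKi hBd hBi)

/-- **THEOREM XVIII with its hypotheses discharged**: the two representations exist, are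
algebraically independent in value, and their `K`-hull is decided and contains `⟦π⟧`.
[this work] -/
theorem soloInformed_kzp_on_hull_ellipticHalf_exists :
    ∃ K E : IntegralRep 1,
      K.domain = {x : Fin 1 → ℝ | x 0 ∈ Ioo (0:ℝ) 1} ∧
      (∀ x, K.integrand x = (√(1 - x 0 ^ 2))⁻¹ * (√(1 - (1 / 2 : ℝ) * x 0 ^ 2))⁻¹) ∧
      E.domain = {x : Fin 1 → ℝ | x 0 ∈ Ioo (0:ℝ) 1} ∧
      (∀ x, E.integrand x = (1 - (1 / 2 : ℝ) * x 0 ^ 2) *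
        ((√(1 - x 0 ^ 2))⁻¹ * (√(1 - (1 / 2 : ℝ) * x 0 ^ 2))⁻¹)) ∧
      AlgebraicIndependent ℚ ![K.value, E.value] ∧
      toFormalPeriod (of KZ.piRep) ∈
        soloInformedAlgHull ![toFormalPeriod (of K), toFormalPeriod (of E)] ∧
      ∀ {n m : ℕ} (r : IntegralRep n) (r' : IntegralRep m),
        toFormalPeriod (of r) ∈ soloInformedAlgHull ![toFormalPeriod (of K), toFormalPeriod (of E)] →
        toFormalPeriod (of r') ∈ soloInformedAlgHull ![toFormalPeriod (of K), toFormalPeriod (of E)] →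
        r.value = r'.value → Equivalent r r' := by
  have hμ : (1 / 2 : ℝ) ∈ Ioo (0:ℝ) 1 := ⟨by norm_num, by norm_num⟩
  have hμa : IsAlgebraic ℚ (1 / 2 : ℝ) := by
    simpa using (isAlgebraic_nat (R := ℚ) (A := ℝ) 2).inv
  obtain ⟨K, hKd, hKi⟩ := soloInformed_exists_ellipticK_rep (1 / 2) hμ hμa
  obtain ⟨E, hEd, hEi⟩ := soloInformed_exists_ellipticE_rep (1 / 2) hμ hμa
  exact ⟨K, E, hKd, hKi, hEd, hEi,
    soloInformed_algebraicIndependent_ellipticHalf K E hKd (fun x _ => hKi x) hEd (fun x _ => hEi x),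
    soloInformed_piRep_mem_hull_ellipticHalf K E hKd (fun x _ => hKi x) hEd (fun x _ => hEi x),
    fun r r' hr hr' hv => soloInformed_kzp_on_hull_ellipticHalf K E hKd (fun x _ => hKi x) hEd
      (fun x _ => hEi x) r r' hr hr' hv⟩

/-! ### THEOREM XVII′-K: Grothendieck's conjecture for `H¹(E_μ)` decides the whole sector `A_μ` -/

/-- Independence of a quadruple of values, in the form the hull theorems consume. [folklore] -/
theorem soloInformed_algebraicIndependent_evalP_four {u v w z : FormalPeriodRing}
    (h : AlgebraicIndependent ℚ ![evalP u, evalP v, evalP w, evalP z]) :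
    AlgebraicIndependent ℚ fun i => evalP (![u, v, w, z] i) := by
  convert h using 1
  funext i
  fin_cases i <;> rfl

/-- `⟦π⟧ ∈ K[⟦K_μ⟧, ⟦K_{1−μ}⟧, ⟦E_μ⟧, ⟦E_{1−μ}⟧]` for every real algebraic modulus — Legendre's relation in
`P` (THEOREM XVII) exhibits `⟦π⟧` as a polynomial in the four elliptic classes; so the elliptic sector
`A_μ = K[⟦K⟧,⟦K'⟧,⟦E⟧,⟦E'⟧,⟦π⟧]` is the `K`-hull of the four classes alone. [this work] -/
theorem soloInformed_piRep_mem_hull_elliptic (μ : ℝ) (hμ : μ ∈ Ioo (0:ℝ) 1) (hμa : IsAlgebraic ℚ μ)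
    (K K' E E' : IntegralRep 1)
    (hKd : K.domain = {x : Fin 1 → ℝ | x 0 ∈ Ioo (0:ℝ) 1})
    (hKi : EqOn K.integrand (fun x => (√(1 - x 0 ^ 2))⁻¹ * (√(1 - μ * x 0 ^ 2))⁻¹) K.domain)
    (hK'd : K'.domain = {x : Fin 1 → ℝ | x 0 ∈ Ioo (0:ℝ) 1})
    (hK'i : EqOn K'.integrand
      (fun x => (√(1 - x 0 ^ 2))⁻¹ * (√(1 - (1 - μ) * x 0 ^ 2))⁻¹) K'.domain)
    (hEd : E.domain = {x : Fin 1 → ℝ | x 0 ∈ Ioo (0:ℝ) 1})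
    (hEi : EqOn E.integrand
      (fun x => (1 - μ * x 0 ^ 2) * ((√(1 - x 0 ^ 2))⁻¹ * (√(1 - μ * x 0 ^ 2))⁻¹)) E.domain)
    (hE'd : E'.domain = {x : Fin 1 → ℝ | x 0 ∈ Ioo (0:ℝ) 1})
    (hE'i : EqOn E'.integrand (fun x => (1 - (1 - μ) * x 0 ^ 2) *
      ((√(1 - x 0 ^ 2))⁻¹ * (√(1 - (1 - μ) * x 0 ^ 2))⁻¹)) E'.domain) :
    toFormalPeriod (of KZ.piRep) ∈ soloInformedAlgHull
      ![toFormalPeriod (of K), toFormalPeriod (of K'), toFormalPeriod (of E), toFormalPeriod (of E')] := by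
  rw [← soloInformed_legendre_relation μ hμ hμa K K' E E' hKd hKi hK'd hK'i hEd hEi hE'd hE'i]
  set c : Fin 4 → FormalPeriodRing :=
    ![toFormalPeriod (of K), toFormalPeriod (of K'), toFormalPeriod (of E), toFormalPeriod (of E')] with hc
  have hK : toFormalPeriod (of K) ∈ soloInformedAlgHull c := soloInformed_mem_algHull_self c 0
  have hK' : toFormalPeriod (of K') ∈ soloInformedAlgHull c := soloInformed_mem_algHull_self c 1
  have hE : toFormalPeriod (of E) ∈ soloInformedAlgHull c := soloInformed_mem_algHull_self c 2
  have hE' : toFormalPeriod (of E') ∈ soloInformedAlgHull c := soloInformed_mem_algHull_self c 3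
  exact mul_mem (ofNat_mem _ 2)
    (sub_mem (add_mem (mul_mem hE hK') (mul_mem hE' hK)) (mul_mem hK hK'))

/-- **THEOREM XVII′-K (Grothendieck ⟹ Kontsevich–Zagier on the elliptic sector).**  If the four values
of one-dimensional representations `K, K', E, E'` are algebraically independent over `ℚ`, then the
Kontsevich–Zagier conjecture HOLDS on the hull `K[⟦K⟧,⟦K'⟧,⟦E⟧,⟦E'⟧]`: representations of any
dimensions with classes in the hull and equal values are equivalent under the moves.  The case of
interest is the Legendre quadruple `K(k), K'(k), E(k), E'(k)` (`k² = μ` real algebraic, pinned as in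
`soloInformed_legendre_relation`), whose algebraic independence is the concrete form of Grothendieck's
period conjecture for `H¹` of the Legendre curve `y² = (1−x²)(1−μx²)` (non-CM case); there the hull is
the sector `A_μ ∋ ⟦π⟧` (`soloInformed_piRep_mem_hull_elliptic`, by THEOREM XVII), and no
`π`-cancellation residual remains.  Unconditional in the calculus; the only input is the transcendence
hypothesis. [this work] -/
theorem soloInformed_kzp_on_hull_elliptic_of_algebraicIndependent (K K' E E' : IntegralRep 1)
    (hGPC : AlgebraicIndependent ℚ ![K.value, K'.value, E.value, E'.value])
    {n m : ℕ} (r : IntegralRep n) (r' : IntegralRep m)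
    (hr : toFormalPeriod (of r) ∈ soloInformedAlgHull
      ![toFormalPeriod (of K), toFormalPeriod (of K'), toFormalPeriod (of E), toFormalPeriod (of E')])
    (hr' : toFormalPeriod (of r') ∈ soloInformedAlgHull
      ![toFormalPeriod (of K), toFormalPeriod (of K'), toFormalPeriod (of E), toFormalPeriod (of E')])
    (hv : r.value = r'.value) : Equivalent r r' := by
  refine soloInformed_kzp_on_algHull _ (soloInformed_algebraicIndependent_evalP_four ?_) r r' hr hr' hv
  simpa only [evalP_toFormalPeriod_of] using hGPC

end Summit.KontsevichZagierPeriods.KontsevichZagierPeriods.Theorems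

end
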